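import Summits.CriticalPhenomena.PercolationContinuityZ3.Theorems.Transplant.AutEndStateFC
import Summits.CriticalPhenomena.PercolationContinuityZ3.Theorems.Transplant.AutProperVirtuallyNilpotent
import Mathlib.GroupTheory.SemidirectProduct
import HarnessLib

/-!
# The FC-split end state for ABSTRACT cocompact actions with finite stabilisers, by name: `p_c < 1` and `θ_x(p_c) = 0` at every vertex of every connected
# locally finite graph on which a group with two independent characters and a CENTRAL element they do not kill acts by automorphisms with finitely many
# orbits and finite vertex stabilisers — in particular every such action of `K × ℤ^d`, `d ≥ 2`, `K` of ANY growth (the intermediate-growth periodic nets)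

builds on p205010 (kernel theorem, internal audit signed; external expert review pending).  Lane `prim-bschramm`, seat `prim-bschramm-gen-1` gen 7 (GEN pen,
p3 lineage), CUSTOMERS of the design owner p3-g32's covering-route theorem «AutEndStateFC» (`AutCyl.conj4_of_orbitDatum_central`, RULING L-Q3-2) through
gen-5 g3's descent «AutProperVirtuallyNilpotent» `AutCyl.exists_endStateInput_of_stabilizers_finite` (the action's image `A₀ ≤ Aut(G)`, the character descended).
Helper file (`--supports stmt-CriticalPhenomena-4575 --as helper`); def-free; unconditional.  NOTHING is claimed about the `@[conjecture]`
`BenjaminiSchramm1996_conj4_endState`: only its central / FC-split sub-case is used, exactly as landed in «AutEndStateFC».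

WHAT IS ALREADY IN THE TREE (and NOT restated here): ONE orbit (a transitive `A`) is the one-type node's («SkeletonFrmScaled1CustomersHoldsA»
`AutChart.criticalContinuity_of_autSubgroup_holds`, no central element needed); `A` virtually NILPOTENT is «AutProperVirtuallyNilpotent» (gen-5 g3); finitely many
orbits WITH single-edge axis steps on a transversal is «AutChartOrbitsCriticalContinuity» (p3 g28).  WHAT THIS FILE ADDS: finitely many orbits, `A` of ANY growth and
no hypothesis on the edges, at the price of a central element of non-trivial character (p3-g32's FC hypothesis, discharging the quasi-step node's cylinder hypothesis
by the Martineau–Severo covering route).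

* §1 `AutCyl.conj4_fc_of_finiteStabilizers` — `A` acting by automorphisms on a connected locally finite `X` with finitely many orbits and finite stabilisers
  of the representatives, `ψ₀, ψ₁ : A → ℤ` independent on some pair, `z ∈ A` with `(ψ₀ z, ψ₁ z) ≠ 0` commuting with a finite-index `N ≤ A` ⟹
  `p_c(x) < 1 ∧ θ_x(p_c) = 0` at every vertex `x`; `conj4_central_of_finiteStabilizers` (`z` central, `N = A`); `conj4_virtualFC_of_finiteStabilizers`
  (characters and witness on a finite-index `A₁ ≤ A`); `conj4_central_of_free` (free actions).
* §2 named instances: `conj4_prod_zd_of_finiteStabilizers` — every such action of `K × ℤ^d`, `d ≥ 2`, `K` ANY group; `conj4_prod_z_of_finiteStabilizers` —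
  of `K × ℤ` with `b₁(K) ≥ 1`.  The Cayley-graph forms are «AutEndStateFCCayley».
[cite: BenjaminiSchramm1996, Conj. 4; §2 (almost transitive graphs)] [cite: MartineauSevero2019, Cor. 2.2] [cite: Hutchcroft2016, Thm. 1.1]
-/

noncomputable section

namespace Summit.CriticalPhenomena.PercolationContinuityZ3.Theorems.Transplant

namespace AutCyl

open SimpleGraph Literature.Barriers.CriticalPhenomena Literature.Probability.LatticeModels Literature.Probability.Percolation
open scoped Classical

variable {W : Type} {X : SimpleGraph W} [X.LocallyFinite] {A : Type} [Group A] [MulAction A W]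

/-! ## §1 Cocompact actions with finite stabilisers of a group with a central element of non-trivial character -/

/-- **FC FORM — `p_c < 1` and `θ_x(p_c) = 0` at every vertex of every connected locally finite graph carrying an action by automorphisms, with finitely many
orbits and FINITE stabilisers, of a group `A` with two independent characters `ψ₀, ψ₁ : A → ℤ` and an element `z` with `(ψ₀ z, ψ₁ z) ≠ 0` commuting with a
FINITE-INDEX subgroup `N ≤ A`** — unconditional: gen-5 g3's descent of the input to `A₀ = im(A → Aut X)` («AutProperVirtuallyNilpotent» §3,
`exists_endStateInput_of_stabilizers_finite`; finite stabilisers are killed by every `ℤ²`-character), under which `z ↦ e z` keeps a non-trivial character and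
`N ↦ N.map e` keeps finite index (`Subgroup.index_map_dvd`) and still commutes with `e z`; then p3-g32's FC-split end state «AutEndStateFC»
`conj4_of_orbitDatum_fc`; `p_c < 1` by the rank-two character («AutChartQuasiTransitive»).  No growth hypothesis, no named fact.
builds on p205010 (kernel theorem, internal audit signed; external expert review pending).
[cite: BenjaminiSchramm1996, Conj. 4; §2 (almost transitive graphs)] [cite: MartineauSevero2019, Cor. 2.2] [cite: Hutchcroft2016, Thm. 1.1] -/
theorem conj4_fc_of_finiteStabilizers (hc : X.Connected) (hact : IsActionByAut X A) (reps : Finset W)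
    (hcover : ∀ w : W, ∃ a : A, ∃ r ∈ reps, a • r = w) (hfin : ∀ r ∈ reps, (MulAction.stabilizer A r : Set A).Finite)
    (ψ₀ ψ₁ : A →* Multiplicative ℤ) (a b : A)
    (hind : Multiplicative.toAdd (ψ₀ a) * Multiplicative.toAdd (ψ₁ b) ≠ Multiplicative.toAdd (ψ₁ a) * Multiplicative.toAdd (ψ₀ b))
    (z : A) (hψz : ψ₀ z ≠ 1 ∨ ψ₁ z ≠ 1) (N : Subgroup A) [hN : N.FiniteIndex] (hNz : ∀ n ∈ N, n * z = z * n) (x : W) :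
    criticalProb X x < 1 ∧ theta X x (criticalProbIOf X x) = 0 := by
  have hfin' : ∀ w : W, (MulAction.stabilizer A w : Set A).Finite := VirtNilpotentAutQT.stabilizer_finite_of_reps reps hcover hfin
  have hne : reps.Nonempty := by
    obtain ⟨-, r, hr, -⟩ := hcover x
    exact ⟨r, hr⟩
  obtain ⟨A₀, e, c, hesurj, -, hce, horb, hstab, hrank⟩ :=
    exists_endStateInput_of_stabilizers_finite (G := X) (reps := reps) hact hfin' hcover hne ψ₀ ψ₁ a b hind
  -- the image of `z` keeps a non-trivial character
  have hg : c (e z) ≠ 1 := by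
    rw [hce]
    intro h
    have h0 : Multiplicative.toAdd (CayleyScaled.pairHom ψ₀ ψ₁ z) 0 = 0 := by rw [h, toAdd_one, Pi.zero_apply]
    have h1 : Multiplicative.toAdd (CayleyScaled.pairHom ψ₀ ψ₁ z) 1 = 0 := by rw [h, toAdd_one, Pi.zero_apply]
    rw [CayleyScaled.toAdd_pairHom_zero] at h0
    rw [CayleyScaled.toAdd_pairHom_one] at h1
    rcases hψz with h' | h'
    · exact h' (toAdd_eq_zero.1 h0)
    · exact h' (toAdd_eq_zero.1 h1)
  -- the image of `N` keeps finite index and commutes with `e z`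
  haveI : (N.map e).FiniteIndex := ⟨fun h0 => by
    have hd := Subgroup.index_map_dvd N hesurj
    rw [h0, zero_dvd_iff] at hd
    exact hN.1 hd⟩
  have hN' : ∀ n' ∈ N.map e, n' * e z = e z * n' := fun n' hn' => by
    obtain ⟨n, hn, rfl⟩ := Subgroup.mem_map.1 hn'
    rw [← map_mul, ← map_mul, hNz n hn]
  refine ⟨?_, conj4_of_orbitDatum_fc X hc A₀ reps c horb hstab hrank (e z) hg (N.map e) hN' x⟩
  -- `p_c < 1`: the rank-two character on `A` itself kills the (finite) stabiliser of `x`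
  refine AutChart.criticalProb_lt_one_of_finite_orbits hact hc x reps hcover (CayleyScaled.pairHom ψ₀ ψ₁)
    (fun h hh => AutPoly.map_eq_one_of_finite_image _ (MulAction.stabilizer A x) ((hfin' x).image _) hh) ⟨a, b, ?_⟩ x
  rw [MaxArea.det2, CayleyScaled.toAdd_pairHom_zero, CayleyScaled.toAdd_pairHom_one, CayleyScaled.toAdd_pairHom_zero,
    CayleyScaled.toAdd_pairHom_one]
  exact sub_ne_zero.2 hind

/-- **`p_c < 1` and `θ_x(p_c) = 0` at every vertex of every connected locally finite graph carrying an action by automorphisms, with finitely many orbits and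
FINITE stabilisers, of a group `A` with two independent characters `ψ₀, ψ₁ : A → ℤ` and a CENTRAL `z` with `(ψ₀ z, ψ₁ z) ≠ 0`** (the case `N = A` of
`conj4_fc_of_finiteStabilizers`).  No growth hypothesis (`K × ℤ²`-periodic nets with `K` of intermediate growth included), no named fact.
builds on p205010 (kernel theorem, internal audit signed; external expert review pending).
[cite: BenjaminiSchramm1996, Conj. 4; §2 (almost transitive graphs)] [cite: MartineauSevero2019, Cor. 2.2] [cite: Hutchcroft2016, Thm. 1.1] -/
theorem conj4_central_of_finiteStabilizers (hc : X.Connected) (hact : IsActionByAut X A) (reps : Finset W)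
    (hcover : ∀ w : W, ∃ a : A, ∃ r ∈ reps, a • r = w) (hfin : ∀ r ∈ reps, (MulAction.stabilizer A r : Set A).Finite)
    (ψ₀ ψ₁ : A →* Multiplicative ℤ) (a b : A)
    (hind : Multiplicative.toAdd (ψ₀ a) * Multiplicative.toAdd (ψ₁ b) ≠ Multiplicative.toAdd (ψ₁ a) * Multiplicative.toAdd (ψ₀ b))
    (z : A) (hz : z ∈ Subgroup.center A) (hψz : ψ₀ z ≠ 1 ∨ ψ₁ z ≠ 1) (x : W) :
    criticalProb X x < 1 ∧ theta X x (criticalProbIOf X x) = 0 :=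
  conj4_fc_of_finiteStabilizers hc hact reps hcover hfin ψ₀ ψ₁ a b hind z hψz ⊤ (fun n _ => (Subgroup.mem_center_iff.1 hz) n) x

/-- **VIRTUAL form — the characters and the FC witness may live on a FINITE-INDEX subgroup `A₁ ≤ A`**: `A` acting by automorphisms with finitely many orbits and
finite stabilisers, `A₁ ≤ A` of finite index with two independent characters `ψ₀, ψ₁ : A₁ → ℤ` and `z ∈ A₁`, `(ψ₀ z, ψ₁ z) ≠ 0`, commuting with a finite-index
`N ≤ A₁` ⟹ `p_c < 1 ∧ θ_x(p_c) = 0` at every vertex (restrict the action to `A₁`: finitely many orbits by gen-1 g6's `exists_reps_of_finiteIndex`, finite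
stabilisers by gen-5 g3's `stabilizer_subgroup_finite`; then `conj4_fc_of_finiteStabilizers`).  E.g. cocompact actions of `(K × ℤ^d) ⋊ F`, `F` finite.
builds on p205010 (kernel theorem, internal audit signed; external expert review pending).
[cite: BenjaminiSchramm1996, Conj. 4; §2 (almost transitive graphs)] [cite: MartineauSevero2019, Cor. 2.2] [cite: Hutchcroft2016, Thm. 1.1] -/
theorem conj4_virtualFC_of_finiteStabilizers (hc : X.Connected) (hact : IsActionByAut X A) (reps : Finset W)
    (hcover : ∀ w : W, ∃ a : A, ∃ r ∈ reps, a • r = w) (hfin : ∀ r ∈ reps, (MulAction.stabilizer A r : Set A).Finite)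
    (A₁ : Subgroup A) [A₁.FiniteIndex] (ψ₀ ψ₁ : A₁ →* Multiplicative ℤ) (a b : A₁)
    (hind : Multiplicative.toAdd (ψ₀ a) * Multiplicative.toAdd (ψ₁ b) ≠ Multiplicative.toAdd (ψ₁ a) * Multiplicative.toAdd (ψ₀ b))
    (z : A₁) (hψz : ψ₀ z ≠ 1 ∨ ψ₁ z ≠ 1) (N : Subgroup A₁) [N.FiniteIndex] (hNz : ∀ n ∈ N, n * z = z * n) (x : W) :
    criticalProb X x < 1 ∧ theta X x (criticalProbIOf X x) = 0 := by
  have hfin' : ∀ w : W, (MulAction.stabilizer A w : Set A).Finite := VirtNilpotentAutQT.stabilizer_finite_of_reps reps hcover hfin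
  obtain ⟨reps₁, hcover₁⟩ := exists_reps_of_finiteIndex A₁ reps hcover
  exact conj4_fc_of_finiteStabilizers hc (isActionByAut_subgroup hact A₁) reps₁ hcover₁ (fun r _ => stabilizer_subgroup_finite hfin' A₁ r)
    ψ₀ ψ₁ a b hind z hψz N hNz x

/-- **Free actions** (trivial, hence finite, stabilisers): the same conclusion. builds on p205010 (kernel theorem, internal audit signed; external expert review pending).
[cite: BenjaminiSchramm1996, Conj. 4; §2 (almost transitive graphs)] [cite: MartineauSevero2019, Cor. 2.2] -/
theorem conj4_central_of_free (hc : X.Connected) (hact : IsActionByAut X A) (hfree : ∀ (g : A) (w : W), g • w = w → g = 1) (reps : Finset W)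
    (hcover : ∀ w : W, ∃ a : A, ∃ r ∈ reps, a • r = w) (ψ₀ ψ₁ : A →* Multiplicative ℤ) (a b : A)
    (hind : Multiplicative.toAdd (ψ₀ a) * Multiplicative.toAdd (ψ₁ b) ≠ Multiplicative.toAdd (ψ₁ a) * Multiplicative.toAdd (ψ₀ b))
    (z : A) (hz : z ∈ Subgroup.center A) (hψz : ψ₀ z ≠ 1 ∨ ψ₁ z ≠ 1) (x : W) :
    criticalProb X x < 1 ∧ theta X x (criticalProbIOf X x) = 0 := by
  refine conj4_central_of_finiteStabilizers hc hact reps hcover (fun r _ => ?_) ψ₀ ψ₁ a b hind z hz hψz x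
  have h1 : (MulAction.stabilizer A r : Set A) = {1} := by
    ext g
    simp only [SetLike.mem_coe, MulAction.mem_stabilizer_iff, Set.mem_singleton_iff]
    exact ⟨hfree g r, fun h => by rw [h, one_smul]⟩
  rw [h1]
  exact Set.finite_singleton 1

/-! ## §2 Named instances: `K × ℤ^d` (`d ≥ 2`) and `K × ℤ` (`b₁(K) ≥ 1`) acting with finitely many orbits and finite stabilisers -/

/-- The `i`-th coordinate character of `ℤ^d` (written multiplicatively). [folklore] -/
private theorem toAdd_evalHom' {d : ℕ} (i : Fin d) (v : Multiplicative (Fin d → ℤ)) :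
    Multiplicative.toAdd ((AddMonoidHom.toMultiplicative (Pi.evalAddMonoidHom (fun _ : Fin d => ℤ) i)) v) = Multiplicative.toAdd v i := rfl

/-- **The central datum of `K × ℤ^d`, `d ≥ 2`**: the first two coordinate characters of the `ℤ^d` factor are independent on `(1, e₀), (1, e₁)`, and `(1, e₀)` is
central and not killed. [folklore] -/
theorem exists_centralDatum_prod_zd (K : Type) [Group K] {d : ℕ} (hd : 2 ≤ d) :
    ∃ (ψ₀ ψ₁ : K × Multiplicative (Fin d → ℤ) →* Multiplicative ℤ) (a b : K × Multiplicative (Fin d → ℤ)),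
      Multiplicative.toAdd (ψ₀ a) * Multiplicative.toAdd (ψ₁ b) ≠ Multiplicative.toAdd (ψ₁ a) * Multiplicative.toAdd (ψ₀ b) ∧
      a ∈ Subgroup.center (K × Multiplicative (Fin d → ℤ)) ∧ ψ₀ a ≠ 1 := by
  set i₀ : Fin d := ⟨0, by omega⟩ with hi₀
  set i₁ : Fin d := ⟨1, by omega⟩ with hi₁
  have hne : i₁ ≠ i₀ := fun h => by
    have := congrArg Fin.val h
    rw [hi₀, hi₁] at this
    exact one_ne_zero this
  let ψ : Fin d → (Multiplicative (Fin d → ℤ) →* Multiplicative ℤ) := fun i =>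
    AddMonoidHom.toMultiplicative (Pi.evalAddMonoidHom (fun _ : Fin d => ℤ) i)
  have hψ : ∀ i v, Multiplicative.toAdd (ψ i v) = Multiplicative.toAdd v i := fun i v => toAdd_evalHom' i v
  let u : Fin d → Multiplicative (Fin d → ℤ) := fun i => Multiplicative.ofAdd (Pi.single i 1)
  have hu : ∀ i j, Multiplicative.toAdd (ψ i (u j)) = (Pi.single j (1 : ℤ) : Fin d → ℤ) i := fun i j => by rw [hψ]; rfl
  refine ⟨(ψ i₀).comp (MonoidHom.snd K _), (ψ i₁).comp (MonoidHom.snd K _), (1, u i₀), (1, u i₁), ?_,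
    Subgroup.mem_center_iff.2 fun y => Prod.ext ?_ (mul_comm y.2 _), ?_⟩
  · show Multiplicative.toAdd (ψ i₀ (u i₀)) * Multiplicative.toAdd (ψ i₁ (u i₁)) ≠
      Multiplicative.toAdd (ψ i₁ (u i₀)) * Multiplicative.toAdd (ψ i₀ (u i₁))
    rw [hu, hu, hu, hu, Pi.single_eq_same, Pi.single_eq_same, Pi.single_eq_of_ne hne, Pi.single_eq_of_ne hne.symm]
    norm_num
  · show y.1 * 1 = 1 * y.1
    rw [mul_one, one_mul]
  · intro h
    have h1 : Multiplicative.toAdd (ψ i₀ (u i₀)) = 0 := by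
      have h' : ψ i₀ (u i₀) = 1 := h
      rw [h', toAdd_one]
    rw [hu, Pi.single_eq_same] at h1
    exact one_ne_zero h1

/-- **Every action of `K × ℤ^d`, `d ≥ 2`, `K` ANY group, by automorphisms with finitely many orbits and finite stabilisers on a connected locally finite graph:
`p_c < 1` and `θ_x(p_c) = 0` at every vertex** — the `K × ℤ^d`-periodic nets, `K` of any growth (intermediate growth included).
builds on p205010 (kernel theorem, internal audit signed; external expert review pending).
[cite: BenjaminiSchramm1996, Conj. 4; §2 (almost transitive graphs)] [cite: MartineauSevero2019, Cor. 2.2] [cite: Hutchcroft2016, Thm. 1.1] -/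
theorem conj4_prod_zd_of_finiteStabilizers {K : Type} [Group K] {d : ℕ} (hd : 2 ≤ d) [MulAction (K × Multiplicative (Fin d → ℤ)) W]
    (hc : X.Connected) (hact : IsActionByAut X (K × Multiplicative (Fin d → ℤ))) (reps : Finset W)
    (hcover : ∀ w : W, ∃ a : K × Multiplicative (Fin d → ℤ), ∃ r ∈ reps, a • r = w)
    (hfin : ∀ r ∈ reps, (MulAction.stabilizer (K × Multiplicative (Fin d → ℤ)) r : Set (K × Multiplicative (Fin d → ℤ))).Finite) (x : W) :
    criticalProb X x < 1 ∧ theta X x (criticalProbIOf X x) = 0 := by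
  obtain ⟨ψ₀, ψ₁, a, b, hind, ha, hψa⟩ := exists_centralDatum_prod_zd K hd
  exact conj4_central_of_finiteStabilizers hc hact reps hcover hfin ψ₀ ψ₁ a b hind a ha (Or.inl hψa) x

/-- **Every action of `(K × ℤ^d) ⋊ F`, `d ≥ 2`, `F` FINITE acting by ANY automorphisms of `K × ℤ^d`, `K` ANY group, by automorphisms with finitely many orbits and
finite stabilisers on a connected locally finite graph: `p_c < 1` and `θ_x(p_c) = 0` at every vertex** — the virtual form at `A₁ = inl(K × ℤ^d)` (index `|F|`),
the datum of `exists_centralDatum_prod_zd` transported along `K × ℤ^d ≃* inl(K × ℤ^d)`; the characters need not extend to the whole group.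
builds on p205010 (kernel theorem, internal audit signed; external expert review pending).
[cite: BenjaminiSchramm1996, Conj. 4; §2 (almost transitive graphs)] [cite: MartineauSevero2019, Cor. 2.2] [cite: Hutchcroft2016, Thm. 1.1] -/
theorem conj4_semidirect_prod_zd_of_finiteStabilizers {K F : Type} [Group K] [Group F] [Finite F] {d : ℕ} (hd : 2 ≤ d)
    (φ : F →* MulAut (K × Multiplicative (Fin d → ℤ))) [MulAction ((K × Multiplicative (Fin d → ℤ)) ⋊[φ] F) W]
    (hc : X.Connected) (hact : IsActionByAut X ((K × Multiplicative (Fin d → ℤ)) ⋊[φ] F)) (reps : Finset W)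
    (hcover : ∀ w : W, ∃ a : (K × Multiplicative (Fin d → ℤ)) ⋊[φ] F, ∃ r ∈ reps, a • r = w)
    (hfin : ∀ r ∈ reps, (MulAction.stabilizer ((K × Multiplicative (Fin d → ℤ)) ⋊[φ] F) r :
      Set ((K × Multiplicative (Fin d → ℤ)) ⋊[φ] F)).Finite) (x : W) :
    criticalProb X x < 1 ∧ theta X x (criticalProbIOf X x) = 0 := by
  obtain ⟨ψ₀, ψ₁, a, b, hind, ha, hψa⟩ := exists_centralDatum_prod_zd K hd
  set ι : K × Multiplicative (Fin d → ℤ) →* (K × Multiplicative (Fin d → ℤ)) ⋊[φ] F := SemidirectProduct.inl with hι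
  haveI : ι.range.FiniteIndex := ⟨by
    rw [hι, SemidirectProduct.range_inl_eq_ker_rightHom, Subgroup.index_ker,
      MonoidHom.range_eq_top.2 SemidirectProduct.rightHom_surjective, Subgroup.card_top]
    exact Nat.card_pos.ne'⟩
  let e : K × Multiplicative (Fin d → ℤ) ≃* ι.range := MonoidHom.ofInjective SemidirectProduct.inl_injective
  have hχ : ∀ (ψ : K × Multiplicative (Fin d → ℤ) →* Multiplicative ℤ) y, (ψ.comp e.symm.toMonoidHom) (e y) = ψ y := fun ψ y => by
    show ψ (e.symm (e y)) = _; rw [MulEquiv.symm_apply_apply]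
  refine conj4_virtualFC_of_finiteStabilizers hc hact reps hcover hfin ι.range (ψ₀.comp e.symm.toMonoidHom) (ψ₁.comp e.symm.toMonoidHom)
    (e a) (e b) ?_ (e a) ?_ ⊤ (fun n _ => ?_) x
  · rw [hχ, hχ, hχ, hχ]; exact hind
  · rw [hχ, hχ]; exact Or.inl hψa
  · obtain ⟨y, rfl⟩ := e.surjective n
    rw [← map_mul, ← map_mul, (Subgroup.mem_center_iff.1 ha) y]

/-- **Every action of `K × ℤ`, `K` with a non-trivial character `χ : K → ℤ` (`b₁(K) ≥ 1`), by automorphisms with finitely many orbits and finite stabilisers on a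
connected locally finite graph: `p_c < 1` and `θ_x(p_c) = 0` at every vertex.**
builds on p205010 (kernel theorem, internal audit signed; external expert review pending).
[cite: BenjaminiSchramm1996, Conj. 4; §2 (almost transitive graphs)] [cite: MartineauSevero2019, Cor. 2.2] -/
theorem conj4_prod_z_of_finiteStabilizers {K : Type} [Group K] (χ : K →* Multiplicative ℤ) (k : K) (hk : χ k ≠ 1)
    [MulAction (K × Multiplicative ℤ) W] (hc : X.Connected) (hact : IsActionByAut X (K × Multiplicative ℤ)) (reps : Finset W)
    (hcover : ∀ w : W, ∃ a : K × Multiplicative ℤ, ∃ r ∈ reps, a • r = w)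
    (hfin : ∀ r ∈ reps, (MulAction.stabilizer (K × Multiplicative ℤ) r : Set (K × Multiplicative ℤ)).Finite) (x : W) :
    criticalProb X x < 1 ∧ theta X x (criticalProbIOf X x) = 0 := by
  have hk' : Multiplicative.toAdd (χ k) ≠ 0 := fun h => hk (toAdd_eq_zero.1 h)
  refine conj4_central_of_finiteStabilizers hc hact reps hcover hfin (MonoidHom.snd K (Multiplicative ℤ))
    (χ.comp (MonoidHom.fst K (Multiplicative ℤ))) (1, Multiplicative.ofAdd 1) (k, 1) ?_ (1, Multiplicative.ofAdd 1)
    (Subgroup.mem_center_iff.2 fun y => Prod.ext ?_ (mul_comm y.2 _)) (Or.inl ?_) x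
  · show Multiplicative.toAdd (Multiplicative.ofAdd (1 : ℤ)) * Multiplicative.toAdd (χ k) ≠
      Multiplicative.toAdd (χ 1) * Multiplicative.toAdd (1 : Multiplicative ℤ)
    rw [toAdd_ofAdd, one_mul, map_one, toAdd_one, zero_mul]
    exact hk'
  · show y.1 * 1 = 1 * y.1
    rw [mul_one, one_mul]
  · show Multiplicative.ofAdd (1 : ℤ) ≠ 1
    exact fun h => one_ne_zero (ofAdd_eq_one.1 h)

end AutCyl

end Summit.CriticalPhenomena.PercolationContinuityZ3.Theorems.Transplant

end
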